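import Summits.RiemannHypothesis.RiemannHypothesis.Theorems.TiltedLandingLaw421Seam01
import Literature.Analysis.Complex.RectangleSlitContour

/-! # TiltedLandingLaw421 — descent seam, part 02
Token-identical port of the descent framework of `Cruxes/TiltedLandingLaw421/Lines/law421birthS.lean`
(seam canon ce03e18b) into flat Theorems modules, so that crux line files can import it instead of inlining it.
No new mathematics; no `sorry`; no route (Theses) imports — the tree statement is mirrored as `RhW07.Seam.Law421Statement`. -/

noncomputable section
open Complex
namespace RhIdea6.G17.W07C7
open Literature.NumberTheory.LFunctions Literature.NumberTheory.DiophantineGeometry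
open Summit.RiemannHypothesis.RiemannHypothesis.Theses
namespace Annex

/-- `ExplicitDerivativeZeroCountingXi` — seam of the TiltedLandingLaw421 descent framework, part 02 (token-identical port of `Cruxes/TiltedLandingLaw421/Lines/law421birthS.lean`; no new mathematics). -/
def ExplicitDerivativeZeroCountingXi : Prop :=
  ∃ A₀ A₁ T₀ : ℝ, ∀ (k : ℕ) (T H : ℝ), T₀ ≤ T → 1 ≤ H → H ≤ T →
    |(∑ᶠ u ∈ {u : ℂ | iteratedDeriv k riemannXiUpper u = 0 ∧ T < u.re ∧ u.re ≤ T + H},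
        ((analyticOrderAt (iteratedDeriv k riemannXiUpper) u).toNat : ℝ)) - H / (2 * Real.pi) * Real.log (T / (2 * Real.pi))|
      ≤ (A₀ + A₁ * k) * Real.log T

/-- `nonRealCount` — seam of the TiltedLandingLaw421 descent framework, part 02 (token-identical port of `Cruxes/TiltedLandingLaw421/Lines/law421birthS.lean`; no new mathematics). -/
def nonRealCount (g : ℂ → ℂ) (x₀ r : ℝ) : ℝ :=
  ∑ᶠ u ∈ {u : ℂ | g u = 0 ∧ u.im ≠ 0 ∧ |u.re - x₀| ≤ r}, ((analyticOrderAt g u).toNat : ℝ)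

/-- `CountDropCertificate` — seam of the TiltedLandingLaw421 descent framework, part 02 (token-identical port of `Cruxes/TiltedLandingLaw421/Lines/law421birthS.lean`; no new mathematics). -/
def CountDropCertificate : Prop :=
  ∀ (f : ℂ → ℂ) (x₀ r hmax Hs : ℝ), Differentiable ℂ f → (∀ x : ℝ, (f (x : ℂ)).im = 0) →
    (∃ A' B' ρ : ℝ, ρ < 2 ∧ ∀ z : ℂ, ‖f z‖ ≤ A' * Real.exp (B' * ‖z‖ ^ ρ)) →
    (∀ w : ℂ, f w = 0 → |w.im| ≤ Hs) → 0 ≤ hmax → Hs ≤ hmax →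
    nonRealCount (deriv f) x₀ r ≤ nonRealCount f x₀ (r + hmax)

/-- `LevelKDriftXi` — seam of the TiltedLandingLaw421 descent framework, part 02 (token-identical port of `Cruxes/TiltedLandingLaw421/Lines/law421birthS.lean`; no new mathematics). -/
def LevelKDriftXi (η : ℝ) (R : ℝ → ℝ) (K : ℝ → ℕ) (T₁ : ℝ) : Prop :=
  ∀ γ : ℝ, T₁ < γ → ∀ k : ℕ, k ≤ K γ → RemainderBox η (iteratedDeriv k riemannXiUpper) γ (xiSpacing γ) (1 / 2) (R γ)

end Annex
/-- `XiHalfSlabBudget` — seam of the TiltedLandingLaw421 descent framework, part 02 (token-identical port of `Cruxes/TiltedLandingLaw421/Lines/law421birthS.lean`; no new mathematics). -/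
def XiHalfSlabBudget (B : ℕ) (R : ℝ → ℝ) (T₁ : ℝ) : Prop :=
  ∀ γ : ℝ, T₁ < γ → HalfSlabBudget B riemannXiUpper γ (xiSpacing γ) (R γ)

end RhIdea6.G17.W07C7
end
namespace RhIdea6.G17.W07C7.Rev2
open Literature.NumberTheory.LFunctions Literature.NumberTheory.DiophantineGeometry
open Summit.RiemannHypothesis.RiemannHypothesis.Theses
/-- `SeamWindowedSignPatternAllBands` — seam-local copy renamed from `WindowedSignPatternAllBands` to avoid registry conflict (stmt-24730 owns that name). -/
def SeamWindowedSignPatternAllBands (Ethin : ℕ → ℝ → Prop) (K : ℝ → ℕ) (T₀ T₁ cthin c : ℝ) : Prop :=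
  ThinBandLaw Ethin K T₀ T₁ cthin ∧ LowPairLaw K T₀ T₁ cthin c ∧ WindowedLaguerreToDepth xiNLEvent K T₀

/-- `XiColumnBudget` — seam of the TiltedLandingLaw421 descent framework, part 02 (token-identical port of `Cruxes/TiltedLandingLaw421/Lines/law421birthS.lean`; no new mathematics). -/
def XiColumnBudget (B : ℝ → ℕ) (R : ℝ → ℝ) (T₁ : ℝ) : Prop :=
  ∀ γ : ℝ, T₁ < γ → ColumnBudgetMult (B γ) riemannXiUpper γ (xiSpacing γ) (R γ)

/-- `XiHalfSlabBudget` — seam of the TiltedLandingLaw421 descent framework, part 02 (token-identical port of `Cruxes/TiltedLandingLaw421/Lines/law421birthS.lean`; no new mathematics). -/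
def XiHalfSlabBudget (B : ℝ → ℕ) (R : ℝ → ℝ) (T₁ : ℝ) : Prop :=
  ∀ γ : ℝ, T₁ < γ → HalfSlabBudget (B γ) riemannXiUpper γ (xiSpacing γ) (R γ)

/-- `windowedSignPatternAllBands_of_rh_of_rows` — seam of the TiltedLandingLaw421 descent framework, part 02 (token-identical port of `Cruxes/TiltedLandingLaw421/Lines/law421birthS.lean`; no new mathematics). -/
theorem windowedSignPatternAllBands_of_rh_of_rows (hRH : RiemannHypothesis) {Ethin : ℕ → ℝ → Prop} {K : ℝ → ℕ} {T₀ T₁ cthin c : ℝ}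
    (hRows : WindowedLaguerreToDepth xiNLEvent K T₀) : SeamWindowedSignPatternAllBands Ethin K T₀ T₁ cthin c :=
  ⟨thinBandLaw_of_rh hRH Ethin K T₀ T₁ cthin, lowPairLaw_of_rh hRH K T₀ T₁ cthin c, hRows⟩

end RhIdea6.G17.W07C7.Rev2
namespace RhIdea6.G17.W07C7.Rev3
open Literature.NumberTheory.LFunctions Literature.NumberTheory.DiophantineGeometry
open Summit.RiemannHypothesis.RiemannHypothesis.Theses
open RhIdea6.G17.W07C7.Rev2 (SeamWindowedSignPatternAllBands XiColumnBudget XiHalfSlabBudget windowedSignPatternAllBands_of_rh_of_rows)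
/-- `EngineHyps4` — seam of the TiltedLandingLaw421 descent framework, part 02 (token-identical port of `Cruxes/TiltedLandingLaw421/Lines/law421birthS.lean`; no new mathematics). -/
def EngineHyps4 (C η : ℝ) (f : ℂ → ℂ) (x₀ s hmax R Hs : ℝ) (B : ℕ) : Prop :=
  Differentiable ℂ f ∧ (∀ x : ℝ, (f (x : ℂ)).im = 0) ∧
    (∃ A' B' ρ : ℝ, ρ < 2 ∧ ∀ z : ℂ, ‖f z‖ ≤ A' * Real.exp (B' * ‖z‖ ^ ρ)) ∧
    0 < s ∧ C * s ≤ hmax ∧ C * hmax ≤ R ∧ 0 ≤ Hs ∧ (∀ w : ℂ, f w = 0 → |w.im| ≤ Hs) ∧ C * Hs ≤ R ∧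
    (∃ w₀ : ℂ, f w₀ = 0 ∧ w₀.im ≠ 0 ∧ w₀.re = x₀ ∧ |w₀.im| ≤ hmax) ∧
    ColumnBudgetMult B f x₀ s R ∧ HalfSlabBudget B f x₀ s R ∧
    0 ≤ η ∧ C * η ≤ 1 ∧ RemainderBox η f x₀ s hmax R

/-- `TiltedLandingLaw4` — seam of the TiltedLandingLaw421 descent framework, part 02 (token-identical port of `Cruxes/TiltedLandingLaw421/Lines/law421birthS.lean`; no new mathematics). -/
def TiltedLandingLaw4 (A₀ C₀ : ℝ) : Prop :=
  ∀ (η : ℝ) (f : ℂ → ℂ) (x₀ s hmax R Hs : ℝ) (B : ℕ), TiltedLandingEventAt4 A₀ C₀ η f x₀ s hmax R Hs B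

/-- `tiltedLandingEvent4_iff` — seam of the TiltedLandingLaw421 descent framework, part 02 (token-identical port of `Cruxes/TiltedLandingLaw421/Lines/law421birthS.lean`; no new mathematics). -/
theorem tiltedLandingEvent4_iff : TiltedLandingEvent4 ↔ ∃ A₀ C₀ : ℝ, 0 < A₀ ∧ 0 < C₀ ∧ TiltedLandingLaw4 A₀ C₀ := Iff.rfl

/-- `eventConcl_of_law` — seam of the TiltedLandingLaw421 descent framework, part 02 (token-identical port of `Cruxes/TiltedLandingLaw421/Lines/law421birthS.lean`; no new mathematics). -/
theorem eventConcl_of_law {A₀ C₀ η : ℝ} {f : ℂ → ℂ} {x₀ s hmax R Hs : ℝ} {B : ℕ} (hLaw : TiltedLandingLaw4 A₀ C₀)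
    (h : EngineHyps4 C₀ η f x₀ s hmax R Hs B) : EventConcl A₀ f x₀ s hmax R B :=
  hLaw η f x₀ s hmax R Hs B h.1 h.2.1 h.2.2.1 h.2.2.2.1 h.2.2.2.2.1 h.2.2.2.2.2.1 h.2.2.2.2.2.2.1 h.2.2.2.2.2.2.2.1
    h.2.2.2.2.2.2.2.2.1 h.2.2.2.2.2.2.2.2.2.1 h.2.2.2.2.2.2.2.2.2.2.1 h.2.2.2.2.2.2.2.2.2.2.2.1 h.2.2.2.2.2.2.2.2.2.2.2.2.1
    h.2.2.2.2.2.2.2.2.2.2.2.2.2.1 h.2.2.2.2.2.2.2.2.2.2.2.2.2.2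

/-- `XiThickColumnData` — seam of the TiltedLandingLaw421 descent framework, part 02 (token-identical port of `Cruxes/TiltedLandingLaw421/Lines/law421birthS.lean`; no new mathematics). -/
def XiThickColumnData (A₀ C₀ : ℝ) (K : ℝ → ℕ) (T₀ T₁ : ℝ) : Prop :=
  ∀ γ δ : ℝ, T₁ < γ → OffLineZeroAt γ δ → thickBandL (thickEdge C₀) γ δ →
    ∃ (η s hmax R Hs : ℝ) (B : ℕ), EngineHyps4 C₀ η riemannXiUpper γ s hmax R Hs B ∧
      (∀ (k : ℕ) (x : ℝ), (k : ℝ) ≤ A₀ * hmax / s + B + 1 → |x - γ| < R / 2 + Real.sqrt k * hmax → T₀ < x ∧ k ≤ K x)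

/-- `landingLawOnBand_of_law_data` — seam of the TiltedLandingLaw421 descent framework, part 02 (token-identical port of `Cruxes/TiltedLandingLaw421/Lines/law421birthS.lean`; no new mathematics). -/
theorem landingLawOnBand_of_law_data {A₀ C₀ : ℝ} {K : ℝ → ℕ} {T₀ T₁ : ℝ} (hLaw : TiltedLandingLaw4 A₀ C₀)
    (hD : XiThickColumnData A₀ C₀ K T₀ T₁) : LandingLawOnBand xiNLEvent K T₀ T₁ (thickBandL (thickEdge C₀)) := by
  intro γ δ hγ hz hband
  obtain ⟨η, s, hmax, R, Hs, B, hE, hbk⟩ := hD γ δ hγ hz hband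
  obtain ⟨k, hk, x, hx, hev⟩ := eventConcl_of_law hLaw hE
  exact ⟨x, (hbk k x hk hx).1, k, (hbk k x hk hx).2, (nlEventOf_xi_iff k x).1 hev⟩

/-- `TiltedLandingLaw44` — seam of the TiltedLandingLaw421 descent framework, part 02 (token-identical port of `Cruxes/TiltedLandingLaw421/Lines/law421birthS.lean`; no new mathematics). -/
def TiltedLandingLaw44 : Prop := TiltedLandingLaw4 4 4

/-- `xiThickColumnData_of_rh` — seam of the TiltedLandingLaw421 descent framework, part 02 (token-identical port of `Cruxes/TiltedLandingLaw421/Lines/law421birthS.lean`; no new mathematics). -/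
theorem xiThickColumnData_of_rh (hRH : RiemannHypothesis) (A₀ C₀ : ℝ) (K : ℝ → ℕ) (T₀ T₁ : ℝ) : XiThickColumnData A₀ C₀ K T₀ T₁ :=
  fun γ δ _ hz _ ↦ absurd hz (seenClean_of_rh hRH Set.univ γ δ (Set.mem_univ _))

end RhIdea6.G17.W07C7.Rev3
namespace RhIdea6.G17.W07C7.Rev3
open Literature.NumberTheory.LFunctions Literature.NumberTheory.DiophantineGeometry
open Summit.RiemannHypothesis.RiemannHypothesis.Theses
/-- `thickLaw_of_feed3_alone` — seam of the TiltedLandingLaw421 descent framework, part 02 (token-identical port of `Cruxes/TiltedLandingLaw421/Lines/law421birthS.lean`; no new mathematics). -/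
theorem thickLaw_of_feed3_alone {Band : ℝ → ℝ → Prop} {K : ℝ → ℕ} {T₀ T₁ : ℝ} (hfeed : XiEventFeed3 Band K T₀ T₁) :
    LandingLawOnBand xiNLEvent K T₀ T₁ Band := by
  intro γ δ hγ hz hband
  have hK0 : (0 : ℝ) ≤ (K γ : ℝ) := Nat.cast_nonneg _
  have hNpos : (0 : ℝ) < (K γ : ℝ) + 2 := by linarith
  obtain ⟨η, s, hmax, R, Hs, B, hmet, hbk⟩ := hfeed ((K γ : ℝ) + 2) ((K γ : ℝ) + 2) hNpos hNpos γ δ hγ hz hband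
  have key : 0 < s → ((K γ : ℝ) + 2) * s ≤ hmax → ((K γ : ℝ) + 2) * hmax ≤ R → False := by
    intro hs h1 h2
    have hmaxpos : 0 < hmax := lt_of_lt_of_le (mul_pos hNpos hs) h1
    have hR : 0 < R := lt_of_lt_of_le (mul_pos hNpos hmaxpos) h2
    have hB : (0 : ℝ) ≤ (B : ℝ) := Nat.cast_nonneg _
    have hKs : (K γ : ℝ) * s ≤ ((K γ : ℝ) + 2) * hmax := by nlinarith
    have hKle : (K γ : ℝ) ≤ ((K γ : ℝ) + 2) * hmax / s := by
      rw [le_div_iff₀ hs]; exact hKs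
    have hk1 : (((K γ + 1 : ℕ) : ℝ)) ≤ ((K γ : ℝ) + 2) * hmax / s + B + 1 := by
      push_cast; linarith
    have hx1 : |γ - γ| < R / 2 + Real.sqrt ((K γ + 1 : ℕ) : ℝ) * hmax := by
      simp only [sub_self, abs_zero]
      exact add_pos_of_pos_of_nonneg (half_pos hR) (mul_nonneg (Real.sqrt_nonneg _) hmaxpos.le)
    have := (hbk (K γ + 1) γ hk1 hx1).2
    omega
  have hEC : EventConcl ((K γ : ℝ) + 2) riemannXiUpper γ s hmax R B :=
    hmet fun _ _ _ hs h1 h2 _ _ _ _ _ _ _ _ ↦ (key hs h1 h2).elim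
  obtain ⟨k, hk, x, hx, hev⟩ := hEC
  exact ⟨x, (hbk k x hk hx).1, k, (hbk k x hk hx).2, (nlEventOf_xi_iff k x).1 hev⟩

/-- `thickLaw_of_feed4_alone` — seam of the TiltedLandingLaw421 descent framework, part 02 (token-identical port of `Cruxes/TiltedLandingLaw421/Lines/law421birthS.lean`; no new mathematics). -/
theorem thickLaw_of_feed4_alone {C : ℝ} {K : ℝ → ℕ} {T₀ T₁ : ℝ}
    (hfeed : ∀ A' C' : ℝ, 0 < A' → 0 < C' → ∀ γ δ : ℝ, T₁ < γ → OffLineZeroAt γ δ → thickBandL (thickEdge C) γ δ →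
      ∃ (η' s hmax R' Hs : ℝ) (B' : ℕ),
        (TiltedLandingEventAt4 A' C' η' riemannXiUpper γ s hmax R' Hs B' → EventConcl A' riemannXiUpper γ s hmax R' B') ∧
        (∀ (k : ℕ) (x : ℝ), (k : ℝ) ≤ A' * hmax / s + B' + 1 → |x - γ| < R' / 2 + Real.sqrt k * hmax → T₀ < x ∧ k ≤ K x)) :
    LandingLawOnBand xiNLEvent K T₀ T₁ (thickBandL (thickEdge C)) := by
  intro γ δ hγ hz hband
  have hK0 : (0 : ℝ) ≤ (K γ : ℝ) := Nat.cast_nonneg _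
  have hNpos : (0 : ℝ) < (K γ : ℝ) + 2 := by linarith
  obtain ⟨η, s, hmax, R, Hs, B, hmet, hbk⟩ := hfeed ((K γ : ℝ) + 2) ((K γ : ℝ) + 2) hNpos hNpos γ δ hγ hz hband
  have key : 0 < s → ((K γ : ℝ) + 2) * s ≤ hmax → ((K γ : ℝ) + 2) * hmax ≤ R → False := by
    intro hs h1 h2
    have hmaxpos : 0 < hmax := lt_of_lt_of_le (mul_pos hNpos hs) h1
    have hR : 0 < R := lt_of_lt_of_le (mul_pos hNpos hmaxpos) h2
    have hB : (0 : ℝ) ≤ (B : ℝ) := Nat.cast_nonneg _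
    have hKs : (K γ : ℝ) * s ≤ ((K γ : ℝ) + 2) * hmax := by nlinarith
    have hKle : (K γ : ℝ) ≤ ((K γ : ℝ) + 2) * hmax / s := by
      rw [le_div_iff₀ hs]; exact hKs
    have hk1 : (((K γ + 1 : ℕ) : ℝ)) ≤ ((K γ : ℝ) + 2) * hmax / s + B + 1 := by
      push_cast; linarith
    have hx1 : |γ - γ| < R / 2 + Real.sqrt ((K γ + 1 : ℕ) : ℝ) * hmax := by
      simp only [sub_self, abs_zero]
      exact add_pos_of_pos_of_nonneg (half_pos hR) (mul_nonneg (Real.sqrt_nonneg _) hmaxpos.le)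
    have := (hbk (K γ + 1) γ hk1 hx1).2
    omega
  have hEC : EventConcl ((K γ : ℝ) + 2) riemannXiUpper γ s hmax R B :=
    hmet fun _ _ _ hs h1 h2 _ _ _ _ _ _ _ _ _ ↦ (key hs h1 h2).elim
  obtain ⟨k, hk, x, hx, hev⟩ := hEC
  exact ⟨x, (hbk k x hk hx).1, k, (hbk k x hk hx).2, (nlEventOf_xi_iff k x).1 hev⟩

end RhIdea6.G17.W07C7.Rev3
namespace RhIdea6.G17.W07C7.Rev4
open Literature.NumberTheory.LFunctions Literature.NumberTheory.DiophantineGeometry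
open Summit.RiemannHypothesis.RiemannHypothesis.Theses
open RhIdea6.G17.W07C7.Rev2 (SeamWindowedSignPatternAllBands)
open RhIdea6.G17.W07C7.Rev3 (EngineHyps4 TiltedLandingLaw4 TiltedLandingLaw44 XiThickColumnData)
/-- `RadiusBooked` — seam of the TiltedLandingLaw421 descent framework, part 02 (token-identical port of `Cruxes/TiltedLandingLaw421/Lines/law421birthS.lean`; no new mathematics). -/
def RadiusBooked (C₀ T₁ : ℝ) (R : ℝ → ℝ) : Prop := ∀ γ : ℝ, T₁ < γ → C₀ ≤ R γ

/-- `DepthProfileBooked` — seam of the TiltedLandingLaw421 descent framework, part 02 (token-identical port of `Cruxes/TiltedLandingLaw421/Lines/law421birthS.lean`; no new mathematics). -/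
def DepthProfileBooked (A₀ : ℝ) (B : ℝ → ℕ) (K : ℝ → ℕ) (T₀ T₁ : ℝ) (R : ℝ → ℝ) : Prop :=
  ∀ γ : ℝ, T₁ < γ → ∀ (k : ℕ) (x : ℝ), (k : ℝ) ≤ A₀ / (2 * xiSpacing γ) + B γ + 1 →
    |x - γ| < R γ / 2 + Real.sqrt k / 2 → T₀ < x ∧ k ≤ K x

/-- `xiSpacing_pos` — seam of the TiltedLandingLaw421 descent framework, part 02 (token-identical port of `Cruxes/TiltedLandingLaw421/Lines/law421birthS.lean`; no new mathematics). -/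
theorem xiSpacing_pos {T₁ γ : ℝ} (h2π : 2 * Real.pi < T₁) (hγ : T₁ < γ) : 0 < xiSpacing γ := by
  have h2 : (0 : ℝ) < 2 * Real.pi := by positivity
  exact div_pos h2 (Real.log_pos ((one_lt_div h2).2 (h2π.trans hγ)))

/-- `xiUpper_zero_of_offLine` — seam of the TiltedLandingLaw421 descent framework, part 02 (token-identical port of `Cruxes/TiltedLandingLaw421/Lines/law421birthS.lean`; no new mathematics). -/
theorem xiUpper_zero_of_offLine {γ δ : ℝ} (hz : OffLineZeroAt γ δ) : riemannXiUpper ⟨γ, -δ⟩ = 0 := by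
  have hlt : δ < 1 / 2 := hz.lt_half
  obtain ⟨hzero, hδ⟩ := hz
  have hw : (1 / 2 : ℂ) + Complex.I * ⟨γ, -δ⟩ = ⟨1 / 2 + δ, γ⟩ := by
    apply Complex.ext <;> simp
  rw [riemannXiUpper, hw]
  exact (riemannXi_eq_zero_iff_holds _).2 ⟨hzero, by show (0 : ℝ) < 1 / 2 + δ; linarith, by show 1 / 2 + δ < (1 : ℝ); linarith⟩

end RhIdea6.G17.W07C7.Rev4
namespace RhIdea6.G17.W07C7.Rev5
open Literature.NumberTheory.LFunctions Literature.NumberTheory.DiophantineGeometry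
open Summit.RiemannHypothesis.RiemannHypothesis.Theses
open RhIdea6.G17.W07C7.Rev2 (SeamWindowedSignPatternAllBands)
open RhIdea6.G17.W07C7.Rev3 (TiltedLandingLaw4)
open RhIdea6.G17.W07C7.Rev4 (RadiusBooked DepthProfileBooked)
/-- `TiltedLandingLaw42` — seam of the TiltedLandingLaw421 descent framework, part 02 (token-identical port of `Cruxes/TiltedLandingLaw421/Lines/law421birthS.lean`; no new mathematics). -/
def SeamTiltedLandingLaw42 : Prop := TiltedLandingLaw4 4 2

/-- `thickCell_live_only_if` — seam of the TiltedLandingLaw421 descent framework, part 02 (token-identical port of `Cruxes/TiltedLandingLaw421/Lines/law421birthS.lean`; no new mathematics). -/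
theorem thickCell_live_only_if {C₀ γ δ : ℝ} (hz : OffLineZeroAt γ δ) (hband : thickBandL (thickEdge C₀) γ δ) : C₀ * xiSpacing γ < 1 / 2 :=
  lt_of_le_of_lt hband hz.lt_half

end RhIdea6.G17.W07C7.Rev5
namespace RhIdea6.G17.W07C7.Rev6
open Literature.NumberTheory.LFunctions Literature.NumberTheory.DiophantineGeometry
open Summit.RiemannHypothesis.RiemannHypothesis.Theses
open RhIdea6.G17.W07C7.Rev2 (SeamWindowedSignPatternAllBands)
open RhIdea6.G17.W07C7.Rev4 (RadiusBooked xiSpacing_pos xiUpper_zero_of_offLine)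
/-- `EventConcl5` — seam of the TiltedLandingLaw421 descent framework, part 02 (token-identical port of `Cruxes/TiltedLandingLaw421/Lines/law421birthS.lean`; no new mathematics). -/
def EventConcl5 (A D : ℝ) (f : ℂ → ℂ) (x₀ s hmax R Hs : ℝ) (B : ℕ) : Prop :=
  ∃ k : ℕ, (k : ℝ) ≤ A * hmax / s + D * (Hs / s) ^ 2 + B + 1 ∧
    ∃ x : ℝ, |x - x₀| < (k + 3) * R / 2 ∧ NLEventOf f k x

/-- `eventConcl5_of_eventConcl` — seam of the TiltedLandingLaw421 descent framework, part 02 (token-identical port of `Cruxes/TiltedLandingLaw421/Lines/law421birthS.lean`; no new mathematics). -/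
theorem eventConcl5_of_eventConcl {A D : ℝ} {f : ℂ → ℂ} {x₀ s hmax R Hs : ℝ} {B : ℕ} (hD : 0 ≤ D)
    (hwin : ∀ k : ℕ, R / 2 + Real.sqrt k * hmax ≤ (k + 3) * R / 2)
    (h : EventConcl A f x₀ s hmax R B) : EventConcl5 A D f x₀ s hmax R Hs B := by
  obtain ⟨k, hk, x, hx, hev⟩ := h
  refine ⟨k, ?_, x, ?_, hev⟩
  · have : 0 ≤ D * (Hs / s) ^ 2 := mul_nonneg hD (sq_nonneg _)
    linarith
  · have := hwin k
    linarith

/-- `EngineHyps5` — seam of the TiltedLandingLaw421 descent framework, part 02 (token-identical port of `Cruxes/TiltedLandingLaw421/Lines/law421birthS.lean`; no new mathematics). -/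
def EngineHyps5 (C η : ℝ) (f : ℂ → ℂ) (x₀ s hmax R Hs : ℝ) (B : ℕ) : Prop :=
  Differentiable ℂ f ∧ (∀ x : ℝ, (f (x : ℂ)).im = 0) ∧
    (∃ A' B' ρ : ℝ, ρ < 2 ∧ ∀ z : ℂ, ‖f z‖ ≤ A' * Real.exp (B' * ‖z‖ ^ ρ)) ∧
    0 < s ∧ C * s ≤ hmax ∧ C * hmax ≤ R ∧ 3 * hmax < R ∧ 0 ≤ Hs ∧ (∀ w : ℂ, f w = 0 → |w.im| ≤ Hs) ∧ C * Hs ≤ R ∧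
    (∃ w₀ : ℂ, f w₀ = 0 ∧ w₀.im ≠ 0 ∧ w₀.re = x₀ ∧ |w₀.im| ≤ hmax) ∧
    ColumnBudgetMult B f x₀ s R ∧ HalfSlabBudget B f x₀ s R ∧
    0 ≤ η ∧ C * η ≤ 1 ∧ RemainderBox η f x₀ s hmax R

/-- `TiltedLandingEventAt5` — seam of the TiltedLandingLaw421 descent framework, part 02 (token-identical port of `Cruxes/TiltedLandingLaw421/Lines/law421birthS.lean`; no new mathematics). -/
def TiltedLandingEventAt5 (A C D η : ℝ) (f : ℂ → ℂ) (x₀ s hmax R Hs : ℝ) (B : ℕ) : Prop :=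
  EngineHyps5 C η f x₀ s hmax R Hs B → EventConcl5 A D f x₀ s hmax R Hs B

/-- `TiltedLandingLaw5` — seam of the TiltedLandingLaw421 descent framework, part 02 (token-identical port of `Cruxes/TiltedLandingLaw421/Lines/law421birthS.lean`; no new mathematics). -/
def TiltedLandingLaw5 (A₀ C₀ D₀ : ℝ) : Prop :=
  ∀ (η : ℝ) (f : ℂ → ℂ) (x₀ s hmax R Hs : ℝ) (B : ℕ), TiltedLandingEventAt5 A₀ C₀ D₀ η f x₀ s hmax R Hs B

/-- `TiltedLandingLaw421` — seam of the TiltedLandingLaw421 descent framework, part 02 (token-identical port of `Cruxes/TiltedLandingLaw421/Lines/law421birthS.lean`; no new mathematics). -/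
def SeamTiltedLandingLaw421 : Prop := TiltedLandingLaw5 4 2 1

/-- `XiThickColumnData5` — seam of the TiltedLandingLaw421 descent framework, part 02 (token-identical port of `Cruxes/TiltedLandingLaw421/Lines/law421birthS.lean`; no new mathematics). -/
def XiThickColumnData5 (A₀ C₀ D₀ : ℝ) (K : ℝ → ℕ) (T₀ T₁ : ℝ) : Prop :=
  ∀ γ δ : ℝ, T₁ < γ → OffLineZeroAt γ δ → thickBandL (thickEdge C₀) γ δ →
    ∃ (η s hmax R Hs : ℝ) (B : ℕ), EngineHyps5 C₀ η riemannXiUpper γ s hmax R Hs B ∧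
      (∀ (k : ℕ) (x : ℝ), (k : ℝ) ≤ A₀ * hmax / s + D₀ * (Hs / s) ^ 2 + B + 1 → |x - γ| < (k + 3) * R / 2 → T₀ < x ∧ k ≤ K x)

/-- `landingLawOnBand_of_law5_data` — seam of the TiltedLandingLaw421 descent framework, part 02 (token-identical port of `Cruxes/TiltedLandingLaw421/Lines/law421birthS.lean`; no new mathematics). -/
theorem landingLawOnBand_of_law5_data {A₀ C₀ D₀ : ℝ} {K : ℝ → ℕ} {T₀ T₁ : ℝ} (hLaw : TiltedLandingLaw5 A₀ C₀ D₀)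
    (hD : XiThickColumnData5 A₀ C₀ D₀ K T₀ T₁) : LandingLawOnBand xiNLEvent K T₀ T₁ (thickBandL (thickEdge C₀)) := by
  intro γ δ hγ hz hband
  obtain ⟨η, s, hmax, R, Hs, B, hE, hbk⟩ := hD γ δ hγ hz hband
  obtain ⟨k, hk, x, hx, hev⟩ := hLaw η riemannXiUpper γ s hmax R Hs B hE
  exact ⟨x, (hbk k x hk hx).1, k, (hbk k x hk hx).2, (nlEventOf_xi_iff k x).1 hev⟩

/-- `DepthProfileBooked5` — seam of the TiltedLandingLaw421 descent framework, part 02 (token-identical port of `Cruxes/TiltedLandingLaw421/Lines/law421birthS.lean`; no new mathematics). -/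
def DepthProfileBooked5 (A₀ D₀ : ℝ) (B : ℝ → ℕ) (K : ℝ → ℕ) (T₀ T₁ : ℝ) (R : ℝ → ℝ) : Prop :=
  ∀ γ : ℝ, T₁ < γ → ∀ (k : ℕ) (x : ℝ), (k : ℝ) ≤ A₀ / (2 * xiSpacing γ) + D₀ * (1 / xiSpacing γ) ^ 2 + B γ + 1 →
    |x - γ| < (k + 3) * R γ / 2 → T₀ < x ∧ k ≤ K x

/-- `xiThickColumnData5_of_rh` — seam of the TiltedLandingLaw421 descent framework, part 02 (token-identical port of `Cruxes/TiltedLandingLaw421/Lines/law421birthS.lean`; no new mathematics). -/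
theorem xiThickColumnData5_of_rh (hRH : RiemannHypothesis) (A₀ C₀ D₀ : ℝ) (K : ℝ → ℕ) (T₀ T₁ : ℝ) :
    XiThickColumnData5 A₀ C₀ D₀ K T₀ T₁ :=
  fun γ δ _ hz _ ↦ absurd hz (seenClean_of_rh hRH Set.univ γ δ (Set.mem_univ _))

/-- `tiltedLandingLaw5_of_law4` — seam of the TiltedLandingLaw421 descent framework, part 02 (token-identical port of `Cruxes/TiltedLandingLaw421/Lines/law421birthS.lean`; no new mathematics). -/
theorem tiltedLandingLaw5_of_law4 {A₀ C₀ D₀ : ℝ} (hD : 0 ≤ D₀)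
    (hwin : ∀ (k : ℕ) (hmax R : ℝ), 3 * hmax < R → 0 ≤ hmax → R / 2 + Real.sqrt k * hmax ≤ (k + 3) * R / 2)
    (h : Rev3.TiltedLandingLaw4 A₀ C₀) : TiltedLandingLaw5 A₀ C₀ D₀ := by
  intro η f x₀ s hmax R Hs B hE
  obtain ⟨hd, hr, ho, hs, h1, h2, h3r, h3, h4, h5, h6, hB, hHB, hη, hCη, hRB⟩ := hE
  have hmax0 : 0 ≤ hmax := by
    obtain ⟨w₀, -, -, -, hw⟩ := h6
    exact (abs_nonneg _).trans hw
  exact eventConcl5_of_eventConcl hD (fun k ↦ hwin k hmax R h3r hmax0)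
    (h η f x₀ s hmax R Hs B hd hr ho hs h1 h2 h3 h4 h5 h6 hB hHB hη hCη hRB)

end RhIdea6.G17.W07C7.Rev6
namespace RhIdea6.G18.W07C8.Law421BirthS
open Set Complex
open Literature.NumberTheory.LFunctions Literature.NumberTheory.DiophantineGeometry
open Summit.RiemannHypothesis.RiemannHypothesis.Theses
open Summit.RiemannHypothesis.RiemannHypothesis.Theorems.Splittings.JensenWindow (LocalA)
open Summit.RiemannHypothesis.RiemannHypothesis.Theorems.Splittings.EarlyAppointmentsLocalFourierPolya
  (exists_nonLaguerre_critical_of_boundary_sign)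
open RhIdea6.G17.W07C7 RhIdea6.G17.W07C7.Rev6
/-- `InClass` — seam of the TiltedLandingLaw421 descent framework, part 02 (token-identical port of `Cruxes/TiltedLandingLaw421/Lines/law421birthS.lean`; no new mathematics). -/
def InClass (g : ℂ → ℂ) (Hs : ℝ) : Prop :=
  Differentiable ℂ g ∧ (∀ t : ℝ, (g (t : ℂ)).im = 0) ∧
    (∃ A' B' ρ : ℝ, ρ < 2 ∧ ∀ z : ℂ, ‖g z‖ ≤ A' * Real.exp (B' * ‖z‖ ^ ρ)) ∧
    (∀ w : ℂ, g w = 0 → |w.im| ≤ Hs)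

/-- `OffJensenDiscs` — seam of the TiltedLandingLaw421 descent framework, part 02 (token-identical port of `Cruxes/TiltedLandingLaw421/Lines/law421birthS.lean`; no new mathematics). -/
def OffJensenDiscs (g : ℂ → ℂ) (p : ℂ) : Prop :=
  ∀ u : ℂ, g u = 0 → u.im ≠ 0 → u.im ^ 2 < (p.re - u.re) ^ 2 + p.im ^ 2

/-- `ShadowFreeWindow` — seam of the TiltedLandingLaw421 descent framework, part 02 (token-identical port of `Cruxes/TiltedLandingLaw421/Lines/law421birthS.lean`; no new mathematics). -/
def ShadowFreeWindow (g : ℂ → ℂ) (α β H : ℝ) : Prop :=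
  α < β ∧ 0 < H ∧ g α ≠ 0 ∧ g β ≠ 0 ∧ deriv g α ≠ 0 ∧ deriv g β ≠ 0 ∧
    (∀ x ∈ Icc α β, OffJensenDiscs g ((x : ℂ) + (H : ℂ) * I)) ∧
    (∀ y ∈ Ioc (0 : ℝ) H, OffJensenDiscs g ((α : ℂ) + (y : ℂ) * I)) ∧
    (∀ y ∈ Ioc (0 : ℝ) H, OffJensenDiscs g ((β : ℂ) + (y : ℂ) * I)) ∧
    LocalA g α β H ∧ (∃ ρ ∈ Ioo α β ×ℂ Ioo (-H) H, g ρ = 0 ∧ ρ.im ≠ 0)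

/-- `DescentSig` — seam of the TiltedLandingLaw421 descent framework, part 02 (token-identical port of `Cruxes/TiltedLandingLaw421/Lines/law421birthS.lean`; no new mathematics). -/
def DescentSig : Prop := ∀ (η : ℝ) (f : ℂ → ℂ) (x₀ s hmax R Hs : ℝ) (B : ℕ),
  EngineHyps5 2 η f x₀ s hmax R Hs B →
    ∃ (j : ℕ) (α β H : ℝ), (j : ℝ) ≤ 4 * hmax / s + (Hs / s) ^ 2 + B ∧
      x₀ - (j + 3) * R / 2 ≤ α ∧ β ≤ x₀ + (j + 3) * R / 2 ∧
      iteratedDeriv j f ≠ 0 ∧ ShadowFreeWindow (iteratedDeriv j f) α β H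

/-- `SignWindow` — seam of the TiltedLandingLaw421 descent framework, part 02 (token-identical port of `Cruxes/TiltedLandingLaw421/Lines/law421birthS.lean`; no new mathematics). -/
def SignWindow (g : ℂ → ℂ) (α β H : ℝ) : Prop :=
  α < β ∧ 0 < H ∧ g α ≠ 0 ∧ g β ≠ 0 ∧ deriv g α ≠ 0 ∧ deriv g β ≠ 0 ∧
    (∀ x ∈ Icc α β, (deriv g ((x : ℂ) + (H : ℂ) * I) / g ((x : ℂ) + (H : ℂ) * I)).im < 0) ∧
    (∀ y ∈ Ioc (0 : ℝ) H, (deriv g ((α : ℂ) + (y : ℂ) * I) / g ((α : ℂ) + (y : ℂ) * I)).im < 0) ∧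
    (∀ y ∈ Ioc (0 : ℝ) H, (deriv g ((β : ℂ) + (y : ℂ) * I) / g ((β : ℂ) + (y : ℂ) * I)).im < 0) ∧
    LocalA g α β H ∧ (∃ ρ ∈ Ioo α β ×ℂ Ioo (-H) H, g ρ = 0 ∧ ρ.im ≠ 0)

/-- `DescentSigS` — seam of the TiltedLandingLaw421 descent framework, part 02 (token-identical port of `Cruxes/TiltedLandingLaw421/Lines/law421birthS.lean`; no new mathematics). -/
def DescentSigS : Prop := ∀ (η : ℝ) (f : ℂ → ℂ) (x₀ s hmax R Hs : ℝ) (B : ℕ),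
  EngineHyps5 2 η f x₀ s hmax R Hs B →
    ∃ (j : ℕ) (α β H : ℝ), (j : ℝ) ≤ 4 * hmax / s + (Hs / s) ^ 2 + B ∧
      x₀ - (j + 3) * R / 2 ≤ α ∧ β ≤ x₀ + (j + 3) * R / 2 ∧
      iteratedDeriv j f ≠ 0 ∧ SignWindow (iteratedDeriv j f) α β H

/-- `OffJensenSignSig` — seam of the TiltedLandingLaw421 descent framework, part 02 (token-identical port of `Cruxes/TiltedLandingLaw421/Lines/law421birthS.lean`; no new mathematics). -/
def OffJensenSignSig : Prop := ∀ (g : ℂ → ℂ) (Hs : ℝ) (p : ℂ),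
  InClass g Hs → g ≠ 0 → (∃ u : ℂ, g u = 0) → 0 < p.im → OffJensenDiscs g p → (deriv g p / g p).im < 0

/-- `AnalyticHereditySig` — seam of the TiltedLandingLaw421 descent framework, part 02 (token-identical port of `Cruxes/TiltedLandingLaw421/Lines/law421birthS.lean`; no new mathematics). -/
def AnalyticHereditySig : Prop := ∀ (f : ℂ → ℂ) (Hs : ℝ) (j : ℕ),
  0 ≤ Hs → InClass f Hs → iteratedDeriv j f ≠ 0 → InClass (iteratedDeriv j f) Hs

/-- `descentSigS_of_descentSig` — seam of the TiltedLandingLaw421 descent framework, part 02 (token-identical port of `Cruxes/TiltedLandingLaw421/Lines/law421birthS.lean`; no new mathematics). -/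
theorem descentSigS_of_descentSig (hSign : OffJensenSignSig) (hHer : AnalyticHereditySig) (hDesc : DescentSig) : DescentSigS := by
  intro η f x₀ s hmax R Hs B hE
  have hE' := hE
  obtain ⟨hdiff, hreal, hgrowth, hs, hsh, hhR, h3R, hHs, hstrip, hHsR, hpair, hcol, hhalf, hη0, hη1, hrem⟩ := hE'
  have hC0 : InClass f Hs := ⟨hdiff, hreal, hgrowth, hstrip⟩
  obtain ⟨j, α, β, H, hj, hα, hβ, hnz, hW⟩ := hDesc η f x₀ s hmax R Hs B hE
  obtain ⟨hlt, hH, hgα, hgβ, hdα, hdβ, hTop, hL, hRt, hA, hz⟩ := hW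
  have hCj : InClass (iteratedDeriv j f) Hs := hHer f Hs j hHs hC0 hnz
  have hsome : ∃ u : ℂ, iteratedDeriv j f u = 0 := by
    obtain ⟨ρ, -, hρ, -⟩ := hz
    exact ⟨ρ, hρ⟩
  refine ⟨j, α, β, H, hj, hα, hβ, hnz, hlt, hH, hgα, hgβ, hdα, hdβ, ?_, ?_, ?_, hA, hz⟩
  · exact fun x hx ↦ hSign _ Hs _ hCj hnz hsome (by rw [Literature.Analysis.Complex.im_ofReal_add_ofReal_mul_I]; exact hH) (hTop x hx)
  · exact fun y hy ↦ hSign _ Hs _ hCj hnz hsome (by rw [Literature.Analysis.Complex.im_ofReal_add_ofReal_mul_I]; exact hy.1) (hL y hy)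
  · exact fun y hy ↦ hSign _ Hs _ hCj hnz hsome (by rw [Literature.Analysis.Complex.im_ofReal_add_ofReal_mul_I]; exact hy.1) (hRt y hy)


end RhIdea6.G18.W07C8.Law421BirthS
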